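import Literature.RingTheory.SimpleModule.CommutantCommutativeCMCriterion
import Literature.AlgebraicGeometry.HodgeTheory.HodgeEndomorphismsHOneOfRiemann
import Literature.AlgebraicGeometry.Motives.AbelianVarietyEndAlgebraSemisimple
import HarnessLib

/-!
# Milne's commutant criterion for complex multiplication, on the carrier `AbelianVariety ℂ`: a complex abelian variety
# `A` is of CM-type iff the commutant of `End⁰(A)` in `End_ℚ H¹(A(ℂ); ℚ)` — or in `End_Ω(H¹(A(ℂ); ℚ) ⊗ Ω)`, any field
# `Ω ⊇ ℚ` — is commutative; and then the commutant is `C(A) ⊗ Ω`, `C(A)` the centre of `End⁰(A)`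
# (Milne, *Complex Multiplication* Ch. I Prop. 3.3)

Family `hodge`, lane `lit-hodgefound` (Track 2 foundations library; skeleton seat `lit-hodgefound-skel-3`, generation 56,
row **A3-G140** FILE 3), topic `Literature/AlgebraicGeometry/ComplexMultiplication`, namespace
`Literature.AlgebraicGeometry.ComplexMultiplication`.  THEOREMS ONLY (no definition, no instance, no named fact; D-0026
net debt `0`).  Sequel BY NAME of FILE 1 `RingTheory/SimpleModule/CommutantCommutativeCMCriterion` (the linear algebra:
`Commutant.exists_comm_isReduced_iff_centralizer_comm`, `…_iff_centralizer_baseChange_comm`,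
`centralizer_le_self_of_centralizer_comm`, `centralizer_eq_map_center_of_exists_comm_isReduced`,
`centralizer_baseChange_eq_span_center`), of the tree's rational representation `bettiRepOp A : End⁰(A)ᵐᵒᵖ →ₐ[ℚ]
End_ℚ H¹(A(ℂ); ℚ)` (`HodgeTheory/HodgeEndomorphismsHOneOfRiemann`, injective: `bettiRepOp_injective`; un-opposed
form of `ComplexMultiplication.bettiRep`, `f ↦ f^*`), of `Milne1999.IsOfCMType` («`End⁰(A)` contains a commutative
reduced `ℚ`-subalgebra of dimension `2 dim A`» — Milne's (b)), of Mumford §19 Cor. 2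
`Motives.AbelianVariety.isSemisimpleRing_endAlgebra_of_isAlgClosed` (`End⁰(A)` is semisimple) and of
`HodgeTheory.finrank_bettiCohomology_one` (`dim_ℚ H¹ = 2 dim A`).

## The print

J. S. Milne, *Complex Multiplication* (course notes v0.10, 2020) [MilneCM2006], Ch. I §3 Prop. 3.3 (pp. 27–28, open text
`paper:url-8ccc30e4daab`), VERBATIM: «PROPOSITION 3.3 The following conditions on an abelian variety `A` are equivalent:
(a) `A` has complex multiplication; (b) `End⁰(A)` contains an étale subalgebra of degree `2 dim A` over `ℚ`; (c) for any
Weil cohomology `X ⇝ H^*(X)` with coefficient field `Ω`, the centralizer of `End⁰(A)` in `End_Ω(H¹(A))` is commutative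
(and equals `C(A) ⊗_ℚ Ω`, where `C(A)` is the centre of `End⁰(A)`).  PROOF. … From the definition of a Weil cohomology,
one deduces that `H¹(A)` has dimension `2 dim A` over `Ω`, and that `End⁰(A) ⊗_ℚ Ω` acts faithfully on it …»

## What is proved

`A : AbelianVariety ℂ`; `End⁰(A) = A.endAlgebra`; `H¹ = bettiCohomology A.X 1 = H¹(A(ℂ); ℚ)` (Betti cohomology, the Weil
cohomology with `Ω = ℚ`; coefficients `Ω = K ⊇ ℚ` are read on `K ⊗_ℚ H¹`); `End⁰(A)` acts on `H¹` by pull-back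
`f ↦ f^*`, i.e. through `bettiRepOp A : End⁰(A)ᵐᵒᵖ → End_ℚ H¹` (the opposite algebra has the same commutant and the same
commutative subalgebras).  «The centralizer of `End⁰(A)` in `End_Ω(H¹(A))`» =
`Subalgebra.centralizer Ω {(f^*)_Ω | f ∈ End⁰(A)}`.

* §1 (transport, private): commutative reduced subalgebras of given dimension of `End⁰(A)`, of `End⁰(A)ᵐᵒᵖ` and of its
  faithful image in `End_ℚ H¹` correspond.
* §2 **`isOfCMType_iff_centralizer_comm`** — MILNE PROP. 3.3 (b) ⟺ (c) for `Ω = ℚ`: `A` is of CM-type iff the commutant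
  of `End⁰(A)` in `End_ℚ H¹(A(ℂ); ℚ)` is commutative; elementwise **`isOfCMType_iff_forall_commute`** (any two
  endomorphisms of `H¹(A(ℂ); ℚ)` commuting with every `f^*` commute with each other);
  **`isOfCMType_iff_centralizer_baseChange_comm`** (any coefficient field `K ⊇ ℚ`, on `K ⊗_ℚ H¹`).
* §3 «and equals `C(A) ⊗_ℚ Ω`»: `centralizer_le_range_of_centralizer_comm` ((c) ⟹ the commutant consists of pull-backs
  `f^*`), **`IsOfCMType.mem_centralizer_iff_exists_mem_center`** (under CM, `x` commutes with `End⁰(A)` iff `x = c^*` for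
  a central `c ∈ End⁰(A)`), `IsOfCMType.centralizer_eq_map_center`,
  **`IsOfCMType.centralizer_baseChange_eq_span_center`** (over `K`: the commutant is the `K`-span of the `(c^*)_K`,
  `c ∈ C(A)`).

Milne's (a) — `2 dim A = [End⁰(A) : ℚ]_red` — is not in the tree (no reduced degree); the tree's `IsOfCMType` IS (b), and
FILE 2 (`NumberTheory/ComplexMultiplication/CMAlgebraTorusCommutantCriterion`) gives the torus-level (a) ⟺ (c) with
Deligne's (a) «`MT(A)` is commutative».

## Relation to the tree's earlier forms of (b) ⟺ (c) (recorded after acceptance; junctions in the sequel `CMTypeCommutantCriterionJunctions`)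

The EQUIVALENCE (b) ⟺ (c) was already in the tree in two other vocabularies, proved by a different road (the Hodge group —
«`L(A) ⊃ Hg(A)`», Deligne I Prop. 3.4 / 5.1 and Riemann's theorem — where this file follows Milne's own: semisimplicity of
`End⁰(A)` and the double centraliser theorem): on complex cohomology `H¹(A(ℂ); ℂ)`, with Milne's (1999) Lefschetz
centraliser `Milne1999.centralizerAlgebra A` (the commutant of the `φ^* = VanGeemen1994.pullbackOne A φ`), as
`HodgeTheory.isOfCMType_iff_centralizerAlgebra_comm` with `HodgeTheory.centralizerAlgebra_le_span_pullbackOne_of_isOfCMType`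
(`HodgeTheory/CMTypeIffCentralizerCommutative`, cited to Milne 1999 Rem. 1.10); and on `H¹(A(ℂ); ℚ)` with the INTEGRAL
pull-backs `u^*`, `u : A ⟶ A`, as `HodgeTheory.isOfCMType_of_centralizer_bettiCohomology_comm` (⟸) and
`HodgeTheory.commute_of_forall_commute_bettiMap_of_isOfCMType` (⟹).  What THIS file adds is the `End⁰(A)`-form through
`bettiRepOp`, the coefficient field `K ⊇ ℚ` arbitrary, `centralizer_le_range_of_centralizer_comm` and the identification
of the commutant with the image of the CENTRE (`IsOfCMType.centralizer_eq_map_center`,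
`IsOfCMType.centralizer_baseChange_eq_span_center`; these five `IsOfCMType.…` names live in THIS namespace,
`ComplexMultiplication.IsOfCMType.…`, not in `Milne1999.IsOfCMType`, so they are called by name, not by dot notation).
The sequel `ComplexMultiplication/CMTypeCommutantCriterionJunctions` proves that the three vocabularies state one
equivalence (`centralizer_range_bettiCohomology_map_eq`, `map_conjAlgEquiv_centralizer_baseChange_eq_centralizerAlgebra`,
`centralizerAlgebra_comm_iff_centralizer_comm`) and transports the centre identification to `Milne1999.centralizerAlgebra`
(`centralizerAlgebra_eq_span_center_of_isOfCMType`: «`C(A) ⊗ ℂ = C₀(A) ⊗_ℚ ℂ`», Milne 1999 Rem. 1.10).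

## References

* [MilneCM2006] J. S. Milne, *Complex Multiplication* (2006/2020), Ch. I §3 Prop. 3.3 (pp. 27–28).
* [Milne1999] J. S. Milne, *Lefschetz motives and the Tate conjecture*, Compositio Math. 117 (1999), §1 Remark 1.10 (p. 53),
  §2 p. 54 (CM-type).
* [MumfordAV1970] D. Mumford, *Abelian Varieties* (1970), §19 Cor. 2 of Thm. 1 (`End⁰(A)` semisimple).
* [LangeBirkenhake1992] H. Lange, Ch. Birkenhake, *Complex Abelian Varieties* (1992), §1.1 (the rational representation
  is faithful).
-/

noncomputable section

open Module
open scoped TensorProduct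

namespace Literature.AlgebraicGeometry.ComplexMultiplication

open Literature.AlgebraicGeometry.Motives Literature.AlgebraicGeometry.HodgeTheory
open Literature.AlgebraicGeometry.Milne1999 (IsOfCMType)
open Literature.RingTheory.SimpleModule

/-! ## §1 Transport of commutative reduced subalgebras: `End⁰(A)`, `End⁰(A)ᵐᵒᵖ`, its image in `End_ℚ H¹` -/

section Transport

variable {F : Type*} [Field F] {C B : Type*} [Ring C] [Ring B] [Algebra F C] [Algebra F B]

/-- The opposite `S.op ⊆ Cᵐᵒᵖ` of a commutative reduced subalgebra `S ⊆ C` is commutative, reduced, of the same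
dimension. [folklore] -/
private theorem exists_comm_isReduced_op_of (n : ℕ)
    (h : ∃ S : Subalgebra F C, IsReduced S ∧ (∀ x ∈ S, ∀ y ∈ S, x * y = y * x) ∧ finrank F S = n) :
    ∃ S : Subalgebra F Cᵐᵒᵖ, IsReduced S ∧ (∀ x ∈ S, ∀ y ∈ S, x * y = y * x) ∧ finrank F S = n := by
  obtain ⟨S, hred, hcomm, hdim⟩ := h
  refine ⟨S.op, ?_, ?_, ?_⟩
  · constructor
    rintro ⟨x, hx⟩ ⟨k, hk⟩
    have hx' : MulOpposite.unop x ∈ S := Subalgebra.mem_op.1 hx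
    have hk' : (⟨MulOpposite.unop x, hx'⟩ : S) ^ k = 0 := by
      apply Subtype.ext
      have := congrArg (fun z : S.op => MulOpposite.unop (z : Cᵐᵒᵖ)) hk
      simpa using this
    have h0 := hred.eq_zero _ ⟨k, hk'⟩
    have h0' : MulOpposite.unop x = 0 := congrArg Subtype.val h0
    exact Subtype.ext (MulOpposite.unop_injective (by simpa using h0'))
  · intro x hx y hy
    apply MulOpposite.unop_injective
    rw [MulOpposite.unop_mul, MulOpposite.unop_mul]
    exact (hcomm _ (Subalgebra.mem_op.1 hx) _ (Subalgebra.mem_op.1 hy)).symm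
  · rw [← hdim]
    let φ : S.op →ₗ[F] S :=
      { toFun := fun x => ⟨MulOpposite.unop (x : Cᵐᵒᵖ), Subalgebra.mem_op.1 x.2⟩
        map_add' := fun x y => rfl
        map_smul' := fun c x => rfl }
    have hφ : Function.Bijective φ := by
      constructor
      · intro x y hxy
        exact Subtype.ext (MulOpposite.unop_injective (congrArg Subtype.val hxy))
      · rintro ⟨y, hy⟩
        exact ⟨⟨MulOpposite.op y, Subalgebra.mem_op.2 hy⟩, rfl⟩
    exact (LinearEquiv.ofBijective φ hφ).finrank_eq

/-- Conversely, from `Sᵒ ⊆ Cᵐᵒᵖ` to `S ⊆ C`. [folklore] -/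
private theorem exists_comm_isReduced_of_op (n : ℕ)
    (h : ∃ S : Subalgebra F Cᵐᵒᵖ, IsReduced S ∧ (∀ x ∈ S, ∀ y ∈ S, x * y = y * x) ∧ finrank F S = n) :
    ∃ S : Subalgebra F C, IsReduced S ∧ (∀ x ∈ S, ∀ y ∈ S, x * y = y * x) ∧ finrank F S = n := by
  obtain ⟨S, hred, hcomm, hdim⟩ := h
  refine ⟨S.unop, ?_, ?_, ?_⟩
  · constructor
    rintro ⟨x, hx⟩ ⟨k, hk⟩
    have hx' : MulOpposite.op x ∈ S := Subalgebra.mem_unop.1 hx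
    have hk' : (⟨MulOpposite.op x, hx'⟩ : S) ^ k = 0 := by
      apply Subtype.ext
      have := congrArg (fun z : S.unop => MulOpposite.op (z : C)) hk
      simpa using this
    have h0 := hred.eq_zero _ ⟨k, hk'⟩
    have h0' : MulOpposite.op x = 0 := congrArg Subtype.val h0
    exact Subtype.ext (MulOpposite.op_injective (by simpa using h0'))
  · intro x hx y hy
    apply MulOpposite.op_injective
    rw [MulOpposite.op_mul, MulOpposite.op_mul]
    exact (hcomm _ (Subalgebra.mem_unop.1 hx) _ (Subalgebra.mem_unop.1 hy)).symm
  · rw [← hdim]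
    let φ : S.unop →ₗ[F] S :=
      { toFun := fun x => ⟨MulOpposite.op (x : C), Subalgebra.mem_unop.1 x.2⟩
        map_add' := fun x y => rfl
        map_smul' := fun c x => rfl }
    have hφ : Function.Bijective φ := by
      constructor
      · intro x y hxy
        exact Subtype.ext (MulOpposite.op_injective (congrArg Subtype.val hxy))
      · rintro ⟨y, hy⟩
        exact ⟨⟨MulOpposite.unop y, Subalgebra.mem_unop.2 (by simpa using hy)⟩, Subtype.ext (by simp [φ])⟩
    exact (LinearEquiv.ofBijective φ hφ).finrank_eq

/-- Along an INJECTIVE algebra homomorphism `f : C → B`, commutative reduced subalgebras of `C` of dimension `n`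
correspond to those of `B` of dimension `n` contained in `f(C)`. [folklore] -/
private theorem exists_comm_isReduced_iff_of_injective (f : C →ₐ[F] B) (hf : Function.Injective f) (n : ℕ) :
    (∃ S : Subalgebra F C, IsReduced S ∧ (∀ x ∈ S, ∀ y ∈ S, x * y = y * x) ∧ finrank F S = n) ↔
      ∃ L : Subalgebra F B, L ≤ f.range ∧ IsReduced L ∧ (∀ x ∈ L, ∀ y ∈ L, x * y = y * x) ∧ finrank F L = n := by
  constructor
  · rintro ⟨S, hred, hcomm, hdim⟩
    let ψ := Subalgebra.equivMapOfInjective S f hf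
    refine ⟨S.map f, ?_, ?_, ?_, ?_⟩
    · rintro _ ⟨x, -, rfl⟩
      exact ⟨x, rfl⟩
    · haveI := hred
      exact isReduced_of_injective ψ.symm ψ.symm.injective
    · rintro _ ⟨a, ha, rfl⟩ _ ⟨b, hb, rfl⟩
      rw [← map_mul, ← map_mul, hcomm a ha b hb]
    · rw [← hdim]
      exact ψ.symm.toLinearEquiv.finrank_eq
  · rintro ⟨L, hLR, hred, hcomm, hdim⟩
    let S : Subalgebra F C := L.comap f
    have hSL : S.map f = L := by
      ext y
      constructor
      · rintro ⟨x, hx, rfl⟩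
        exact (Subalgebra.mem_comap _ _ _).1 hx
      · intro hy
        obtain ⟨x, rfl⟩ := (AlgHom.mem_range _).1 (hLR hy)
        exact ⟨x, (Subalgebra.mem_comap _ _ _).2 hy, rfl⟩
    let ψ : S ≃ₐ[F] L := (Subalgebra.equivMapOfInjective S f hf).trans (Subalgebra.equivOfEq _ _ hSL)
    refine ⟨S, ?_, ?_, ?_⟩
    · haveI := hred
      exact isReduced_of_injective ψ ψ.injective
    · intro a ha b hb
      apply hf
      rw [map_mul, map_mul]
      exact hcomm _ ((Subalgebra.mem_comap _ _ _).1 ha) _ ((Subalgebra.mem_comap _ _ _).1 hb)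
    · rw [← hdim]
      exact ψ.toLinearEquiv.finrank_eq

/-- The centre of `f(C)`, read in `B`, is `f(Z(C))` for `f` injective. [folklore] -/
private theorem map_val_center_range_eq_map_center (f : C →ₐ[F] B) (hf : Function.Injective f) :
    (Subalgebra.center F f.range).map f.range.val = (Subalgebra.center F C).map f := by
  rw [Commutant.map_val_center_eq_inf_centralizer]
  ext x
  simp only [Algebra.mem_inf, Subalgebra.mem_centralizer_iff, Subalgebra.mem_map, Subalgebra.mem_center_iff,
    SetLike.mem_coe, AlgHom.mem_range]
  constructor
  · rintro ⟨⟨c, rfl⟩, hc⟩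
    refine ⟨c, fun d => hf ?_, rfl⟩
    rw [map_mul, map_mul]
    exact hc (f d) ⟨d, rfl⟩
  · rintro ⟨c, hc, rfl⟩
    refine ⟨⟨c, rfl⟩, ?_⟩
    rintro _ ⟨d, rfl⟩
    rw [← map_mul, ← map_mul, hc d]

end Transport

/-! ## §2 Milne Prop. 3.3 (b) ⟺ (c) for complex abelian varieties -/

variable (A : AbelianVariety ℂ)

/-- `End⁰(A)ᵐᵒᵖ ≅` its image in `End_ℚ H¹(A(ℂ); ℚ)` is semisimple (Mumford §19 Cor. 2; `End⁰(A)ᵐᵒᵖ` is semisimple with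
`End⁰(A)`). [folklore] -/
private theorem isSemisimpleRing_range_bettiRepOp : IsSemisimpleRing ↥(bettiRepOp A).range := by
  haveI : IsSemisimpleRing A.endAlgebra := AbelianVariety.isSemisimpleRing_endAlgebra_of_isAlgClosed A
  exact RingHom.isSemisimpleRing_of_surjective (bettiRepOp A).rangeRestrict.toRingHom
    (bettiRepOp A).rangeRestrict_surjective

/-- **Milne's (b) on the cohomology side**: `A` is of CM-type (`End⁰(A) ⊇` a commutative reduced subalgebra of dimension
`2 dim A`) iff the image of `End⁰(A)` in `End_ℚ H¹(A(ℂ); ℚ)` contains a commutative reduced subalgebra of dimension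
`dim_ℚ H¹ = 2 dim A` (the rational representation is faithful and `dim H¹ = 2 dim A`).
[cite: MilneCM2006, Ch. I §3 Prop. 3.3 (proof: «`H¹(A)` has dimension `2 dim A` over `Ω`, and … `End⁰(A) ⊗_ℚ Ω` acts faithfully on it»)]
[cite: Milne1999, §2 p. 54] -/
theorem isOfCMType_iff_exists_comm_isReduced_le_range :
    IsOfCMType A ↔
      ∃ L : Subalgebra ℚ (Module.End ℚ (bettiCohomology A.X 1)), L ≤ (bettiRepOp A).range ∧ IsReduced L ∧
        (∀ x ∈ L, ∀ y ∈ L, x * y = y * x) ∧ finrank ℚ L = finrank ℚ (bettiCohomology A.X 1) := by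
  rw [Milne1999.isOfCMType_iff, finrank_bettiCohomology_one,
    ← exists_comm_isReduced_iff_of_injective (bettiRepOp A) bettiRepOp_injective]
  exact ⟨exists_comm_isReduced_op_of _, exists_comm_isReduced_of_op _⟩

/-- **MILNE, Complex Multiplication, Ch. I PROP. 3.3 (b) ⟺ (c) for a complex abelian variety `A` (Betti cohomology,
`Ω = ℚ`): `A` is of CM-type iff the commutant of `End⁰(A)` in `End_ℚ H¹(A(ℂ); ℚ)` is commutative.**  `End⁰(A)` is semisimple
(Mumford §19 Cor. 2) and acts faithfully on `H¹` of dimension `2 dim A`; FILE 1's criterion applies.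
[cite: MilneCM2006, Ch. I §3 Prop. 3.3 ((b) ⟺ (c), pp. 27–28)] [cite: MumfordAV1970, §19 Cor. 2 of Thm. 1 (p. 174)] -/
theorem isOfCMType_iff_centralizer_comm :
    IsOfCMType A ↔
      ∀ x ∈ Subalgebra.centralizer ℚ (Set.range (bettiRepOp A)),
        ∀ y ∈ Subalgebra.centralizer ℚ (Set.range (bettiRepOp A)), x * y = y * x := by
  haveI : FiniteDimensional ℚ (bettiCohomology A.X 1) := finite_bettiCohomology_one A
  haveI := isSemisimpleRing_range_bettiRepOp A
  rw [isOfCMType_iff_exists_comm_isReduced_le_range, ← AlgHom.coe_range]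
  exact Commutant.exists_comm_isReduced_iff_centralizer_comm _

/-- **Milne Prop. 3.3 (b) ⟺ (c), elementwise: `A` is of CM-type iff any two endomorphisms of `H¹(A(ℂ); ℚ)` that commute
with every pull-back `f^*`, `f ∈ End⁰(A)`, commute with each other.** [cite: MilneCM2006, Ch. I §3 Prop. 3.3 ((b) ⟺ (c))] -/
theorem isOfCMType_iff_forall_commute :
    IsOfCMType A ↔
      ∀ x y : Module.End ℚ (bettiCohomology A.X 1),
        (∀ f : A.endAlgebraᵐᵒᵖ, bettiRepOp A f * x = x * bettiRepOp A f) →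
          (∀ f : A.endAlgebraᵐᵒᵖ, bettiRepOp A f * y = y * bettiRepOp A f) → x * y = y * x := by
  rw [isOfCMType_iff_centralizer_comm]
  constructor
  · intro h x y hx hy
    refine h x ?_ y ?_
    · rw [Subalgebra.mem_centralizer_iff]; rintro _ ⟨f, rfl⟩; exact hx f
    · rw [Subalgebra.mem_centralizer_iff]; rintro _ ⟨f, rfl⟩; exact hy f
  · intro h x hx y hy
    rw [Subalgebra.mem_centralizer_iff] at hx hy
    exact h x y (fun f => hx _ ⟨f, rfl⟩) (fun f => hy _ ⟨f, rfl⟩)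

/-- **Milne Prop. 3.3 (b) ⟺ (c) with coefficients in a field `K ⊇ ℚ` («for any Weil cohomology `X ⇝ H^*(X)` with coefficient
field `Ω`», here `H¹(A(ℂ); ℚ) ⊗_ℚ K`): `A` is of CM-type iff the commutant of `End⁰(A) ⊗ 1` in `End_K(K ⊗_ℚ H¹(A(ℂ); ℚ))`
is commutative.** [cite: MilneCM2006, Ch. I §3 Prop. 3.3 ((b) ⟺ (c), coefficient field `Ω`)] -/
theorem isOfCMType_iff_centralizer_baseChange_comm (K : Type*) [Field K] [Algebra ℚ K] :
    IsOfCMType A ↔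
      ∀ x ∈ Subalgebra.centralizer K
          ((fun t : Module.End ℚ (bettiCohomology A.X 1) => t.baseChange K) '' Set.range (bettiRepOp A)),
        ∀ y ∈ Subalgebra.centralizer K
          ((fun t : Module.End ℚ (bettiCohomology A.X 1) => t.baseChange K) '' Set.range (bettiRepOp A)),
          x * y = y * x := by
  haveI : FiniteDimensional ℚ (bettiCohomology A.X 1) := finite_bettiCohomology_one A
  haveI := isSemisimpleRing_range_bettiRepOp A
  rw [isOfCMType_iff_exists_comm_isReduced_le_range, ← AlgHom.coe_range]
  exact Commutant.exists_comm_isReduced_iff_centralizer_baseChange_comm K _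

/-! ## §3 «and equals `C(A) ⊗_ℚ Ω`, where `C(A)` is the centre of `End⁰(A)`» -/

/-- (c) ⟹ every endomorphism of `H¹(A(ℂ); ℚ)` commuting with `End⁰(A)` IS a pull-back `f^*`, `f ∈ End⁰(A)` (the commutant
lies in the image of `End⁰(A)`: double centralizer theorem for the semisimple `End⁰(A)`).
[cite: MilneCM2006, Ch. I §3 Prop. 3.3 ((c): «and equals `C(A)`»)] [cite: MumfordAV1970, §19 Cor. 2 of Thm. 1 (p. 174)] -/
theorem centralizer_le_range_of_centralizer_comm
    (hC : ∀ x ∈ Subalgebra.centralizer ℚ (Set.range (bettiRepOp A)),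
      ∀ y ∈ Subalgebra.centralizer ℚ (Set.range (bettiRepOp A)), x * y = y * x) :
    Subalgebra.centralizer ℚ (Set.range (bettiRepOp A)) ≤ (bettiRepOp A).range := by
  haveI : FiniteDimensional ℚ (bettiCohomology A.X 1) := finite_bettiCohomology_one A
  haveI := isSemisimpleRing_range_bettiRepOp A
  have h := Commutant.centralizer_le_self_of_centralizer_comm (bettiRepOp A).range
  rw [AlgHom.coe_range] at h
  exact h hC

variable {A}

/-- **Under CM, the commutant of `End⁰(A)` in `End_ℚ H¹(A(ℂ); ℚ)` «equals `C(A)`»: an endomorphism of `H¹` commutes with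
every `f^*` iff it is `c^*` for a CENTRAL `c ∈ End⁰(A)`.** [cite: MilneCM2006, Ch. I §3 Prop. 3.3 ((c): «and equals `C(A) ⊗_ℚ Ω`, where `C(A)` is the centre of `End⁰(A)`»)] -/
theorem IsOfCMType.mem_centralizer_iff_exists_mem_center (h : IsOfCMType A)
    (x : Module.End ℚ (bettiCohomology A.X 1)) :
    x ∈ Subalgebra.centralizer ℚ (Set.range (bettiRepOp A)) ↔
      ∃ c ∈ Subalgebra.center ℚ A.endAlgebra, bettiRepOp A (MulOpposite.op c) = x := by
  haveI : FiniteDimensional ℚ (bettiCohomology A.X 1) := finite_bettiCohomology_one A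
  have h' := (isOfCMType_iff_exists_comm_isReduced_le_range A).1 h
  rw [← AlgHom.coe_range, Commutant.mem_centralizer_iff_mem_and_forall_comm_of_exists_comm_isReduced h']
  constructor
  · rintro ⟨hxR, hc⟩
    obtain ⟨c', rfl⟩ := (AlgHom.mem_range _).1 hxR
    refine ⟨MulOpposite.unop c', ?_, by rw [MulOpposite.op_unop]⟩
    rw [Subalgebra.mem_center_iff]
    intro b
    apply MulOpposite.op_injective
    apply bettiRepOp_injective
    rw [MulOpposite.op_mul, MulOpposite.op_mul, MulOpposite.op_unop, map_mul, map_mul]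
    exact hc _ ((AlgHom.mem_range _).2 ⟨MulOpposite.op b, rfl⟩)
  · rintro ⟨c, hc, rfl⟩
    refine ⟨(AlgHom.mem_range _).2 ⟨MulOpposite.op c, rfl⟩, fun y hy => ?_⟩
    obtain ⟨d, rfl⟩ := (AlgHom.mem_range _).1 hy
    rw [← map_mul, ← map_mul]
    congr 1
    apply MulOpposite.unop_injective
    rw [MulOpposite.unop_mul, MulOpposite.unop_mul, MulOpposite.unop_op]
    exact (Subalgebra.mem_center_iff.1 hc) (MulOpposite.unop d)

/-- Under CM, the commutant of `End⁰(A)` in `End_ℚ H¹(A(ℂ); ℚ)` is the image of the centre of `End⁰(A)ᵐᵒᵖ` (`= C(A)`).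
[cite: MilneCM2006, Ch. I §3 Prop. 3.3 ((c): «and equals `C(A)`»)] -/
theorem IsOfCMType.centralizer_eq_map_center (h : IsOfCMType A) :
    Subalgebra.centralizer ℚ (Set.range (bettiRepOp A)) =
      (Subalgebra.center ℚ A.endAlgebraᵐᵒᵖ).map (bettiRepOp A) := by
  haveI : FiniteDimensional ℚ (bettiCohomology A.X 1) := finite_bettiCohomology_one A
  have h' := (isOfCMType_iff_exists_comm_isReduced_le_range A).1 h
  rw [← AlgHom.coe_range, Commutant.centralizer_eq_map_center_of_exists_comm_isReduced h',
    map_val_center_range_eq_map_center (bettiRepOp A) bettiRepOp_injective]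

/-- **Under CM, with coefficients `K ⊇ ℚ`: the commutant of `End⁰(A) ⊗ 1` in `End_K(K ⊗_ℚ H¹(A(ℂ); ℚ))` «equals
`C(A) ⊗_ℚ Ω`» — it is the `K`-span of the base changes `(c^*)_K` of the central `c ∈ End⁰(A)`.**
[cite: MilneCM2006, Ch. I §3 Prop. 3.3 ((c): «and equals `C(A) ⊗_ℚ Ω`»)] -/
theorem IsOfCMType.centralizer_baseChange_eq_span_center (h : IsOfCMType A) (K : Type*) [Field K] [Algebra ℚ K] :
    Subalgebra.toSubmodule (Subalgebra.centralizer K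
        ((fun t : Module.End ℚ (bettiCohomology A.X 1) => t.baseChange K) '' Set.range (bettiRepOp A))) =
      Submodule.span K ((fun t : Module.End ℚ (bettiCohomology A.X 1) => t.baseChange K) ''
        ((Subalgebra.center ℚ A.endAlgebraᵐᵒᵖ).map (bettiRepOp A) : Set (Module.End ℚ (bettiCohomology A.X 1)))) := by
  haveI : FiniteDimensional ℚ (bettiCohomology A.X 1) := finite_bettiCohomology_one A
  have h' := (isOfCMType_iff_exists_comm_isReduced_le_range A).1 h
  rw [← AlgHom.coe_range, Commutant.centralizer_baseChange_eq_span_center K _ h',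
    map_val_center_range_eq_map_center (bettiRepOp A) bettiRepOp_injective]

/-- Under CM the commutant of `End⁰(A)` in `End_ℚ H¹(A(ℂ); ℚ)` is commutative ((b) ⟹ (c), stated on its own).
[cite: MilneCM2006, Ch. I §3 Prop. 3.3 ((b) ⟹ (c))] -/
theorem IsOfCMType.centralizer_comm (h : IsOfCMType A) :
    ∀ x ∈ Subalgebra.centralizer ℚ (Set.range (bettiRepOp A)),
      ∀ y ∈ Subalgebra.centralizer ℚ (Set.range (bettiRepOp A)), x * y = y * x :=
  (isOfCMType_iff_centralizer_comm A).1 h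

/-- Under CM the commutant of `End⁰(A) ⊗ 1` in `End_K(K ⊗_ℚ H¹(A(ℂ); ℚ))` is commutative for every field `K ⊇ ℚ`.
[cite: MilneCM2006, Ch. I §3 Prop. 3.3 ((b) ⟹ (c), coefficient field `Ω`)] -/
theorem IsOfCMType.centralizer_baseChange_comm (h : IsOfCMType A) (K : Type*) [Field K] [Algebra ℚ K] :
    ∀ x ∈ Subalgebra.centralizer K
        ((fun t : Module.End ℚ (bettiCohomology A.X 1) => t.baseChange K) '' Set.range (bettiRepOp A)),
      ∀ y ∈ Subalgebra.centralizer K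
        ((fun t : Module.End ℚ (bettiCohomology A.X 1) => t.baseChange K) '' Set.range (bettiRepOp A)),
        x * y = y * x :=
  (isOfCMType_iff_centralizer_baseChange_comm A K).1 h

end Literature.AlgebraicGeometry.ComplexMultiplication

end
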